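import Summits.RiemannHypothesis.RiemannHypothesis.Theses.DBN
import Literature.NumberTheory.LFunctions.EquivalentsHolds
import Literature.NumberTheory.LFunctions.DeBruijnHSimpleZerosProofs

/-!
# RiemannHypothesis / DBN — the ISOLATED statement of column DBN: no coalescence at positive time

LINE 1 — LABEL: `DbnTheory.NoCoalescence` is **RH-EQUIVALENT** (the residual of record of the
Rodgers–Tao / Newman-flow corpus C3, cell `rh-crit/rt`, `RESIDUAL.md`); `DbnTheory.CoalescenceAtLambda`
is **RH-FREE** (its hypothesis `0 < Λ` is the negation of RH, its content a compactness /
continuity statement about the zeros of `H_t` near `t = Λ`).  bears_on: N-C/N-P (LADDER-RH §1,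
COLUMN 3 DBN).  WHAT THIS IS NOT: not a proof target, not a new criterion (it is `Λ ≤ 0`
re-indexed through Csordas–Smith–Varga simplicity), not evidence about RH; formalising the corpus
fixes WHICH inequality would prove RH, it does not move RH — nothing here bears on the truth of RH.

Objects (tree vocabulary): `H_t = Literature.NumberTheory.LFunctions.deBruijnH t`
(`H_t(z) = ∫₀^∞ e^{tu²} Φ(u) cos(zu) du`, Rodgers–Tao normalisation),
`Λ = Literature.NumberTheory.LFunctions.deBruijnNewmanConst`.

* `NoCoalescence` — for every `t > 0`, every REAL zero of `H_t` is simple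
  (`H_t(x) = 0 → H_t'(x) ≠ 0`).  In the language of the zero dynamics
  `∂ₜ x_k = 2 ∑' (x_k − x_j)⁻¹` (Csordas–Smith–Varga 1994; Rodgers–Tao 2020 Thm. 4.1): the gaps
  between consecutive real zeros never close at a positive time.  Inequality form
  (`noCoalescence_iff_norm_sq_pos`): `0 < ‖H_t(x)‖² + ‖H_t'(x)‖²` for all `t > 0`, `x ∈ ℝ`.
* `CoalescenceAtLambda` (K2 of `rt/RESIDUAL.md` §3) — if `0 < Λ` then `H_Λ` (which is real-rooted,
  `hasOnlyRealZeros_deBruijnH_deBruijnNewmanConst`) has a multiple real zero.  RH-FREE leaf content;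
  proved in the sibling files (`DBNSimpleRealZerosPersist`, `DBNUniformFarZerosReal`,
  `DBNCoalescenceAtLambda`); here only STATED, and used as an explicit hypothesis.

Kernel glue (all sorry-free, standard axioms; `Λ ≥ 0` is the tree THEOREM
`deBruijnNewmanConst_nonneg_holds`, Rodgers–Tao 2020 Thm. 1.1 via Dobner 2021, so the only
non-vacuous failure mode of `NoCoalescence` is a coalescence at the time `t = Λ > 0` itself):

* ⟹ (unconditional) `noCoalescence_of_riemannHypothesis`: RH → `Λ ≤ 0`
  (`riemannHypothesis_iff_deBruijnNewmanConst_nonpos`, i.e. `deBruijnNewmanConst_le_iff_holds` at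
  `0` + Newman closedness) → `H_{t/2}` real-rooted → every real zero of `H_t` simple
  (Csordas–Smith–Varga 1994 Thm. 2.2 = `csordasSmithVarga_simple_zeros_holds`); likewise from the
  route-DBN target X = `DBN.DbnThesis` (stmt-RiemannHypothesis-0274): `noCoalescence_of_dbnThesis`.
* ⟸ (modulo the RH-FREE K2) `riemannHypothesis_of_noCoalescence`: either `Λ ≤ 0` (then RH), or
  `0 < Λ` and K2 exhibits a coalescence at the positive time `Λ`, contradicting `NoCoalescence`;
  `dbnThesis_of_noCoalescence` via `deBruijnNewmanConst_le_iff_holds`.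
* Hence `noCoalescence_iff_riemannHypothesis`, `noCoalescence_iff_dbnThesis` (modulo K2):
  with K2 landed the residual is certified RH-EQUIVALENT by decl in both directions.

`--supports stmt-RiemannHypothesis-0274` (route DBN target X); closes nothing.

References: G. Csordas, W. Smith, R. S. Varga, Constr. Approx. 10 (1994) 107–129, Thm. 2.2;
B. Rodgers, T. Tao, Forum Math. Pi 8 (2020) e6 = arXiv:1801.05914, §1 p.3, Thm. 1.1, Thm. 4.1 p.13;
C. M. Newman, Proc. AMS 61 (1976), Thm. 3; N. G. de Bruijn, Duke Math. J. 17 (1950), Thm. 13.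
-/

noncomputable section

-- D-0017: `Summit.<S>.<S>.…` is the designed namespace of a single-problem summit.
set_option linter.dupNamespace false

namespace Summit.RiemannHypothesis.RiemannHypothesis.Theorems.DbnTheory

open Literature.NumberTheory.LFunctions
open Summit.RiemannHypothesis.RiemannHypothesis.Theses

/-! ## The two statements -/

/-- **RH-EQUIVALENT — the ISOLATED statement of column DBN (residual of record, C3).**
No coalescence at any positive time: for every `t > 0`, every real zero of de Bruijn's `H_t` is
simple, `H_t(x) = 0 → H_t'(x) ≠ 0` (`x ∈ ℝ`).  RH ⟹ this (`noCoalescence_of_riemannHypothesis`,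
unconditional); this ⟹ RH modulo the RH-FREE lemma `CoalescenceAtLambda`
(`riemannHypothesis_of_noCoalescence`).  Never a proving target; nothing here bears on the truth of
RH.  (A statement about the tree's `H_t`, not a named fact from print — hence untagged.) -/
def NoCoalescence : Prop :=
  ∀ t : ℝ, 0 < t → ∀ x : ℝ, deBruijnH t x = 0 → deriv (deBruijnH t) x ≠ 0

/-- **RH-FREE — coalescence at a positive de Bruijn–Newman constant (leaf K2).**
If `0 < Λ`, then `H_Λ` has a multiple real zero: some `x ∈ ℝ` with `H_Λ(x) = 0` and
`H_Λ'(x) = 0`.  (`H_Λ` is real-rooted by Newman's closedness,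
`hasOnlyRealZeros_deBruijnH_deBruijnNewmanConst`; were all its real zeros simple, real-rootedness
would persist to some `t < Λ` — simple real zeros stay real on compact boxes by continuity, far
zeros are real uniformly in `t` by Ki–Kim–Lee — contradicting the definition of `Λ`.)  The
hypothesis `0 < Λ` is `¬RH` (`riemannHypothesis_iff_deBruijnNewmanConst_nonpos`), so the statement
is vacuous under RH but is proved WITHOUT deciding RH (sibling file `DBNCoalescenceAtLambda`).
Stated here; taken as an explicit hypothesis below.  (Untagged: a statement about the tree's `H_t`,
proved in a sibling file, not a named fact from print.) -/
def CoalescenceAtLambda : Prop :=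
  0 < deBruijnNewmanConst →
    ∃ x : ℝ, deBruijnH deBruijnNewmanConst x = 0 ∧ deriv (deBruijnH deBruijnNewmanConst) x = 0

/-! ## Inequality form -/

/-- `NoCoalescence` as an inequality: `0 < ‖H_t(x)‖² + ‖H_t'(x)‖²` for all `t > 0` and real `x`.
[folklore] -/
theorem noCoalescence_iff_norm_sq_pos :
    NoCoalescence ↔
      ∀ t : ℝ, 0 < t → ∀ x : ℝ, 0 < ‖deBruijnH t x‖ ^ 2 + ‖deriv (deBruijnH t) x‖ ^ 2 := by
  constructor
  · intro h t ht x
    by_cases hx : deBruijnH t x = 0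
    · have hd : deriv (deBruijnH t) x ≠ 0 := h t ht x hx
      have : 0 < ‖deriv (deBruijnH t) x‖ := norm_pos_iff.2 hd
      positivity
    · have : 0 < ‖deBruijnH t x‖ := norm_pos_iff.2 hx
      positivity
  · intro h t ht x hx hd
    have := h t ht x
    rw [hx, hd, norm_zero] at this
    simp at this

/-! ## RH ⟹ no coalescence (unconditional) -/

/-- If `H_{t₁}` is real-rooted for some `t₁ < t`, every real zero of `H_t` is simple
(Csordas–Smith–Varga 1994, Thm. 2.2, the tree theorem `csordasSmithVarga_simple_zeros_holds`).
[folklore] -/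
theorem deriv_ne_zero_of_hasOnlyRealZeros_lt {t₁ t : ℝ} (hlt : t₁ < t)
    (hreal : HasOnlyRealZeros (deBruijnH t₁)) {x : ℝ} (hx : deBruijnH t x = 0) :
    deriv (deBruijnH t) x ≠ 0 :=
  csordasSmithVarga_simple_zeros_holds t₁ t hlt hreal x hx

/-- **X ⟹ no coalescence**: the route-DBN target `DBN.DbnThesis` (`∀ t > 0`, `H_t` real-rooted;
stmt-RiemannHypothesis-0274) gives `NoCoalescence` — apply Csordas–Smith–Varga between `t/2` and
`t`. [folklore] -/
theorem noCoalescence_of_dbnThesis (h : DBN.DbnThesis) : NoCoalescence :=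
  fun t ht _ hx ↦ deriv_ne_zero_of_hasOnlyRealZeros_lt (by linarith) (h (t / 2) (by positivity)) hx

/-- **RH ⟹ no coalescence** (unconditional in the tree): RH ↔ `Λ ≤ 0`
(`riemannHypothesis_iff_deBruijnNewmanConst_nonpos`: `deBruijnNewmanConst_le_iff_holds` at `0`
with Newman's closedness), so every `H_t`, `t > 0`, is real-rooted, and Csordas–Smith–Varga
applies. [folklore] -/
theorem noCoalescence_of_riemannHypothesis (hRH : RiemannHypothesis) : NoCoalescence := by
  have hΛ : deBruijnNewmanConst ≤ 0 := riemannHypothesis_iff_deBruijnNewmanConst_nonpos.1 hRH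
  exact noCoalescence_of_dbnThesis ((deBruijnNewmanConst_le_iff_holds 0).1 hΛ)

/-! ## No coalescence ⟹ RH, modulo the RH-FREE leaf K2 -/

/-- **No coalescence ⟹ `Λ ≤ 0`**, modulo K2: if `0 < Λ`, K2 gives a multiple real zero of `H_Λ`
at the positive time `Λ`, which `NoCoalescence` forbids. [folklore] -/
theorem deBruijnNewmanConst_nonpos_of_noCoalescence (hK2 : CoalescenceAtLambda)
    (h : NoCoalescence) : deBruijnNewmanConst ≤ 0 := by
  by_contra hpos
  push Not at hpos
  obtain ⟨x, hx, hdx⟩ := hK2 hpos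
  exact h _ hpos x hx hdx

/-- **No coalescence ⟹ X** (the route-DBN target, stmt-RiemannHypothesis-0274), modulo K2:
`Λ ≤ 0` and `deBruijnNewmanConst_le_iff_holds` at `0`. [folklore] -/
theorem dbnThesis_of_noCoalescence (hK2 : CoalescenceAtLambda) (h : NoCoalescence) :
    DBN.DbnThesis :=
  (deBruijnNewmanConst_le_iff_holds 0).1 (deBruijnNewmanConst_nonpos_of_noCoalescence hK2 h)

/-- **THE DOOR — no coalescence ⟹ RH**, modulo the RH-FREE leaf K2 (`CoalescenceAtLambda`):
`Λ ≤ 0` by `deBruijnNewmanConst_nonpos_of_noCoalescence`, then RH by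
`riemannHypothesis_iff_deBruijnNewmanConst_nonpos`.  (With `Λ ≥ 0`,
`deBruijnNewmanConst_nonneg_holds`, the conclusion is `Λ = 0`.) [folklore] -/
theorem riemannHypothesis_of_noCoalescence (hK2 : CoalescenceAtLambda) (h : NoCoalescence) :
    RiemannHypothesis :=
  riemannHypothesis_iff_deBruijnNewmanConst_nonpos.2 (deBruijnNewmanConst_nonpos_of_noCoalescence hK2 h)

/-- Modulo K2, `NoCoalescence` gives `Λ = 0` (with Rodgers–Tao `Λ ≥ 0`,
`deBruijnNewmanConst_nonneg_holds`). [folklore] -/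
theorem deBruijnNewmanConst_eq_zero_of_noCoalescence (hK2 : CoalescenceAtLambda)
    (h : NoCoalescence) : deBruijnNewmanConst = 0 :=
  le_antisymm (deBruijnNewmanConst_nonpos_of_noCoalescence hK2 h) deBruijnNewmanConst_nonneg_holds

/-- **The residual is RH-EQUIVALENT by decl** (modulo K2): `NoCoalescence ↔ RiemannHypothesis`.
[folklore] -/
theorem noCoalescence_iff_riemannHypothesis (hK2 : CoalescenceAtLambda) :
    NoCoalescence ↔ RiemannHypothesis :=
  ⟨riemannHypothesis_of_noCoalescence hK2, noCoalescence_of_riemannHypothesis⟩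

/-- Modulo K2, `NoCoalescence ↔` the route-DBN target X (`DBN.DbnThesis`,
stmt-RiemannHypothesis-0274). [folklore] -/
theorem noCoalescence_iff_dbnThesis (hK2 : CoalescenceAtLambda) :
    NoCoalescence ↔ DBN.DbnThesis :=
  ⟨dbnThesis_of_noCoalescence hK2, noCoalescence_of_dbnThesis⟩

/-- Modulo K2, `NoCoalescence ↔` the summit statement `Summit.RiemannHypothesis`
(definitionally Mathlib's `RiemannHypothesis`). [folklore] -/
theorem noCoalescence_iff_summit (hK2 : CoalescenceAtLambda) :
    NoCoalescence ↔ Summit.RiemannHypothesis :=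
  noCoalescence_iff_riemannHypothesis hK2

end Summit.RiemannHypothesis.RiemannHypothesis.Theorems.DbnTheory

end
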